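import Literature.MathematicalPhysics.QuantumFieldTheory.YangMillsOS
import HarnessLib

/-!
# Lüscher's reference flow time `t₀` (the flow scale) and the `t₀`-scheme

## Content

* `flowScaleOf e` — for a profile `e : ℝ → ℝ` (intended: the expected flowed action density
  `t ↦ ⟨E_t⟩` of a lattice gauge theory, in lattice units) the **reference flow time**
  `t₀ := inf {t > 0 | 3/10 ≤ t² e(t)}`, with junk value `0` when the level `3/10` is never
  reached (`Real.sInf_empty`). Lüscher defines `t₀` through the implicit equation
  `{t² ⟨E⟩}_{t = t₀} = 0.3` [Luscher2010, §3.4 eq. (3.3)]; the least crossing time is well defined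
  without any monotonicity assumption, solves the equation as soon as the profile is continuous
  and bounded (`flowScaleOf_spec`), and is THE solution when `t ↦ t² e(t)` is increasing
  (`flowScaleOf_eq_of_strictMonoOn`), which is what is observed (ibid. §3.3 and fig. 2).
* `flowScale ρ E β S` — `t₀(β, S)`: the reference flow time of the profile
  `t ↦ ∫ E t (torusLift S U) dμ_{S,β}(U)` under the torus Wilson measure `wilsonMeasure ρ β` on
  `(ℤ/Sℤ)ᵈ`, for a flow-time-indexed observable `E : ℝ → LGConfig d G → ℝ` read on the periodic
  lift (as every observable in `YangMillsOS`). Intended instance: `E t U` = the action density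
  `E = 2 ∑_{p ∈ P₀} Re tr{1 − V_t(p)}` [Luscher2010, eq. (3.1)] (or its clover variant, §3.2) of
  the Wilson flow `V_t(U)` [Luscher2010, eq. (1.4)] at the origin — the Literature notion
  `latticeWilsonFlow`, requested separately; the present file is agnostic of that choice and of
  the discretisation of the density.
* `FlowSchemeData r E`, `FlowSchemeData.toSpeciesScheme` — the **`t₀`-scheme**: from inverse
  couplings `β_k`, torus half-sides `L_k` and multiplicative renormalisations `c_s(k)` build the
  `SpeciesScheme (YMSpecies G)` of `YangMillsOS` with
  `a_k := t₀(β_k, 2L_k+1)^{-1/2}` (the flow's own scale setting [Luscher2010, §3.5 (b)]: the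
  reference flow time is `1` in physical units, `toSpeciesScheme_a_sq_mul_t0`) and
  `m_s(k) :=` the exact vacuum subtraction `⟨s ∘ torusLift⟩_{2L_k+1, β_k}` for every species `s`.
  The three side conditions of a `SpeciesScheme` (`a_k > 0`, `a_k → 0`, `a_k L_k → ∞`) become the
  fields `flowScale_pos`, `tendsto_flowScale` (`t₀(β_k, 2L_k+1) → ∞` in lattice units, i.e. the
  continuum limit) and `tendsto_div_sqrt` (`L_k / √t₀ → ∞`, i.e. infinite volume in physical units).
  These fields are genuine input: for the Wilson-flow density, `t₀(β, S) → ∞` as `β → ∞` is the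
  (asymptotic-freedom) statement that the lattice spacing measured by the flow goes to zero — the
  structure is hypothesis data exactly like the side conditions of `SpeciesScheme`, and nothing in
  this file asserts that it is inhabited for that density.

## Design choices

* Mathlib has no scale-setting vocabulary; the nearest notion, `MeasureTheory.hitting` (first
  hitting time of a process in a discrete/ordered window, junk value = the window's end), does not
  fit the junk-`0` convention requested here, so `flowScaleOf` is a plain `sInf` over `ℝ`.
* The multiplicative renormalisations `c` are INPUT data of the `t₀`-scheme: Lüscher's `t₀` fixes
  the lattice spacing only; a normalisation of the curvature species (e.g. by a flowed two-point
  function) is the consumer's to supply through `FlowSchemeData.c`.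
* `flowScale` takes the dimension `d`, representation `ρ`, coupling `β` and side `S` of
  `wilsonMeasure` verbatim; the scheme is four-dimensional (`YMSpecies G` lives on `ℤ⁴`) and uses
  the odd sides `2L_k+1` of `SpeciesScheme.side`.

* IMPORT HYGIENE (definition item `defn-FlowScaleCore`, route `QuantumFields/FlowLineStateSpace`,
  2026-08-16): this module imports `YangMillsOS` (+ `HarnessLib`) ONLY, so that its import cone is
  contained in that of `Summits.QuantumFields.Statement` — no strong-coupling statement files
  (`LatticeGauge`, `LatticeGaugeProofs`, `StrongCouplingActivities`, `Sweep1`, `CorrelationDecay`,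
  `IsingThermodynamics`) and hence none of their unproved named facts enter the cone of a Theses
  file that merely names `t₀`. The one lemma previously taken from `LatticeGaugeProofs`
  (`isProbabilityMeasure_wilsonMeasure`, used by `flowScale_const`) is re-proved here privately
  (`FlowScale.isProbabilityMeasure_wilsonMeasure'`, same elementary argument: `|S| ≤ B` on the
  compact configuration space, so `e^{-|β|B} ≤ Z ≤ e^{|β|B}`). The pure real-analysis API
  (`flowScaleSet` … `flowScaleOf_const_eq`) uses Mathlib only.

## What is NOT here

The Wilson flow itself, bounds on the flowed density, monotonicity of `t² ⟨E_t⟩`, and any claim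
that the `t₀`-scheme has a continuum limit.
-/

open MeasureTheory Filter Set
open scoped Topology
open Literature.MathematicalPhysics.QuantumFieldTheory Literature.Probability.LatticeModels

noncomputable section

namespace Literature.MathematicalPhysics.QuantumLattice

/-! ### The reference flow time of a profile -/

/-- The **crossing set** of a profile `e` (`t ↦ ⟨E_t⟩`): the positive flow times at which
`t² e(t)` has reached Lüscher's level `0.3`. [cite: Luscher2010, §3.4 eq. (3.3)] -/
def flowScaleSet (e : ℝ → ℝ) : Set ℝ := {t | 0 < t ∧ 3 / 10 ≤ t ^ 2 * e t}

/-- **Lüscher's reference flow time** `t₀` of a profile `e` (`t ↦ ⟨E_t⟩`, lattice units):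
the least positive flow time with `t² e(t) ≥ 0.3`, i.e. `sInf (flowScaleSet e)`; junk value `0` if
the level is never reached. Lüscher's implicit equation `{t² ⟨E⟩}_{t=t₀} = 0.3` is solved by it
for continuous bounded profiles (`flowScaleOf_spec`) and has it as unique solution for increasing
`t ↦ t² e(t)` (`flowScaleOf_eq_of_strictMonoOn`). [cite: Luscher2010, §3.4 eq. (3.3)] -/
def flowScaleOf (e : ℝ → ℝ) : ℝ := sInf (flowScaleSet e)

/-- Membership in the crossing set, unfolded. [folklore] -/
@[simp] theorem mem_flowScaleSet {e : ℝ → ℝ} {t : ℝ} :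
    t ∈ flowScaleSet e ↔ 0 < t ∧ 3 / 10 ≤ t ^ 2 * e t := Iff.rfl

/-- The crossing set is bounded below (by `0`). [folklore] -/
theorem bddBelow_flowScaleSet (e : ℝ → ℝ) : BddBelow (flowScaleSet e) :=
  ⟨0, fun _ ht => ht.1.le⟩

/-- `t₀ ≥ 0`. [folklore] -/
theorem flowScaleOf_nonneg (e : ℝ → ℝ) : 0 ≤ flowScaleOf e :=
  Real.sInf_nonneg fun _ ht => ht.1.le

/-- Junk value: if the level `0.3` is never reached, `t₀ = 0`. [folklore] -/
theorem flowScaleOf_eq_zero {e : ℝ → ℝ} (h : ∀ t, 0 < t → t ^ 2 * e t < 3 / 10) :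
    flowScaleOf e = 0 := by
  have hempty : flowScaleSet e = ∅ :=
    Set.eq_empty_of_forall_notMem fun t ht => (h t ht.1).not_ge ht.2
  rw [flowScaleOf, hempty, Real.sInf_empty]

/-- `t₀` is at most any crossing time. [folklore] -/
theorem flowScaleOf_le {e : ℝ → ℝ} {t : ℝ} (ht : 0 < t) (h : 3 / 10 ≤ t ^ 2 * e t) :
    flowScaleOf e ≤ t :=
  csInf_le (bddBelow_flowScaleSet e) ⟨ht, h⟩

/-- If the level is reached at all but not before `T`, then `T ≤ t₀`. [folklore] -/
theorem le_flowScaleOf {e : ℝ → ℝ} {T : ℝ} (hne : (flowScaleSet e).Nonempty)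
    (h : ∀ t, 0 < t → t < T → t ^ 2 * e t < 3 / 10) : T ≤ flowScaleOf e :=
  le_csInf hne fun t ht => not_lt.1 fun hlt => (h t ht.1 hlt).not_ge ht.2

/-- Before `t₀` the level is not reached: `t² e(t) < 0.3` for `0 < t < t₀`. [folklore] -/
theorem sq_mul_lt_of_lt_flowScaleOf {e : ℝ → ℝ} {t : ℝ} (ht : 0 < t) (hlt : t < flowScaleOf e) :
    t ^ 2 * e t < 3 / 10 :=
  not_le.1 fun h => (flowScaleOf_le ht h).not_gt hlt

/-- **Uniqueness**: if `t ↦ t² e(t)` is strictly increasing on `(0, ∞)` and takes the value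
`0.3` at `t₁ > 0`, then `t₀ = t₁` — the least crossing time is Lüscher's implicitly defined
`t₀`. [cite: Luscher2010, §3.4 eq. (3.3)] -/
theorem flowScaleOf_eq_of_strictMonoOn {e : ℝ → ℝ} {t₁ : ℝ}
    (hmono : StrictMonoOn (fun t => t ^ 2 * e t) (Ioi 0)) (ht₁ : 0 < t₁)
    (h : t₁ ^ 2 * e t₁ = 3 / 10) : flowScaleOf e = t₁ := by
  refine le_antisymm (flowScaleOf_le ht₁ h.ge) (le_flowScaleOf ⟨t₁, ht₁, h.ge⟩ fun t ht hlt => ?_)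
  have := hmono ht ht₁ hlt
  simp only at this
  linarith

/-- A lower bound: if the profile is bounded by `C` on `(0, ∞)` and the level is reached, then
`√(3 / (10 C)) ≤ t₀` (any crossing time has `0.3 ≤ t² C`). [folklore] -/
theorem sqrt_le_flowScaleOf {e : ℝ → ℝ} {C : ℝ} (hne : (flowScaleSet e).Nonempty)
    (hC : ∀ t, 0 < t → e t ≤ C) : Real.sqrt (3 / (10 * C)) ≤ flowScaleOf e := by
  refine le_csInf hne fun t ht => ?_
  have h1 : 3 / 10 ≤ t ^ 2 * C :=
    ht.2.trans (mul_le_mul_of_nonneg_left (hC t ht.1) (sq_nonneg t))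
  have hCpos : 0 < C := by
    by_contra hC0
    have : t ^ 2 * C ≤ 0 := mul_nonpos_of_nonneg_of_nonpos (sq_nonneg t) (not_lt.1 hC0)
    linarith
  have h2 : 3 / (10 * C) ≤ t ^ 2 := by
    rw [div_le_iff₀ (by positivity)]
    nlinarith
  calc Real.sqrt (3 / (10 * C)) ≤ Real.sqrt (t ^ 2) := Real.sqrt_le_sqrt h2
    _ = t := Real.sqrt_sq ht.1.le

/-- **Positivity**: for a profile bounded on `(0, ∞)` whose level is reached, `0 < t₀`
(so the junk value `0` occurs exactly when the level is never reached). [folklore] -/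
theorem flowScaleOf_pos {e : ℝ → ℝ} {C : ℝ} (hne : (flowScaleSet e).Nonempty)
    (hC : ∀ t, 0 < t → e t ≤ C) : 0 < flowScaleOf e := by
  obtain ⟨t, ht⟩ := hne
  have h1 : 3 / 10 ≤ t ^ 2 * C :=
    ht.2.trans (mul_le_mul_of_nonneg_left (hC t ht.1) (sq_nonneg t))
  have hCpos : 0 < C := by
    by_contra hC0
    have : t ^ 2 * C ≤ 0 := mul_nonpos_of_nonneg_of_nonpos (sq_nonneg t) (not_lt.1 hC0)
    linarith
  exact (Real.sqrt_pos.2 (by positivity)).trans_le (sqrt_le_flowScaleOf ⟨t, ht⟩ hC)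

/-- **The infimum is attained**: for a profile continuous and bounded on `(0, ∞)` whose level is
reached, `0.3 ≤ t₀² e(t₀)` (the crossing set is closed in `[√(3/(10C)), ∞)`). [folklore] -/
theorem flowScaleOf_mem {e : ℝ → ℝ} {C : ℝ} (hcont : ContinuousOn e (Ioi 0))
    (hne : (flowScaleSet e).Nonempty) (hC : ∀ t, 0 < t → e t ≤ C) :
    flowScaleOf e ∈ flowScaleSet e := by
  set δ := Real.sqrt (3 / (10 * C)) with hδ
  have hδpos : 0 < δ := by
    obtain ⟨t, ht⟩ := hne
    have h1 : 3 / 10 ≤ t ^ 2 * C :=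
      ht.2.trans (mul_le_mul_of_nonneg_left (hC t ht.1) (sq_nonneg t))
    have hCpos : 0 < C := by
      by_contra hC0
      have : t ^ 2 * C ≤ 0 := mul_nonpos_of_nonneg_of_nonpos (sq_nonneg t) (not_lt.1 hC0)
      linarith
    exact Real.sqrt_pos.2 (by positivity)
  -- the crossing set is the closed set `[δ, ∞) ∩ {t | 0.3 ≤ t² e t}`
  have hsub : ∀ t ∈ flowScaleSet e, δ ≤ t := fun t ht =>
    (sqrt_le_flowScaleOf ⟨t, ht⟩ hC).trans (flowScaleOf_le ht.1 ht.2)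
  have hg : ContinuousOn (fun t => t ^ 2 * e t) (Ici δ) :=
    ((continuousOn_id.pow 2).mul (hcont.mono fun t ht => hδpos.trans_le ht))
  have hclosed : IsClosed (Ici δ ∩ (fun t => t ^ 2 * e t) ⁻¹' Ici (3 / 10)) :=
    hg.preimage_isClosed_of_isClosed isClosed_Ici isClosed_Ici
  have heq : flowScaleSet e = Ici δ ∩ (fun t => t ^ 2 * e t) ⁻¹' Ici (3 / 10) := by
    ext t
    refine ⟨fun ht => ⟨hsub t ht, ht.2⟩, fun ht => ⟨hδpos.trans_le ht.1, ht.2⟩⟩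
  have hmem := hclosed.csInf_mem (heq ▸ hne) (heq ▸ bddBelow_flowScaleSet e)
  rw [← heq] at hmem
  exact hmem

/-- **`t₀` solves Lüscher's implicit equation** `t₀² e(t₀) = 0.3` for every profile continuous
and bounded on `(0, ∞)` whose level is reached (attainment, and `t² e(t) < 0.3` for `t < t₀`
passed to the limit `t ↑ t₀`). [cite: Luscher2010, §3.4 eq. (3.3)] -/
theorem flowScaleOf_spec {e : ℝ → ℝ} {C : ℝ} (hcont : ContinuousOn e (Ioi 0))
    (hne : (flowScaleSet e).Nonempty) (hC : ∀ t, 0 < t → e t ≤ C) :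
    flowScaleOf e ^ 2 * e (flowScaleOf e) = 3 / 10 := by
  have hmem := flowScaleOf_mem hcont hne hC
  refine le_antisymm ?_ hmem.2
  have h0 : 0 < flowScaleOf e := hmem.1
  have hg : ContinuousWithinAt (fun t => t ^ 2 * e t) (Ioi 0) (flowScaleOf e) :=
    ((continuousWithinAt_id.pow 2).mul (hcont _ h0))
  have ht : Tendsto (fun t => t ^ 2 * e t) (𝓝[Ioo 0 (flowScaleOf e)] (flowScaleOf e))
      (𝓝 (flowScaleOf e ^ 2 * e (flowScaleOf e))) :=
    hg.tendsto.mono_left (nhdsWithin_mono _ Ioo_subset_Ioi_self)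
  haveI : (𝓝[Ioo 0 (flowScaleOf e)] (flowScaleOf e)).NeBot := right_nhdsWithin_Ioo_neBot h0
  refine le_of_tendsto ht (eventually_nhdsWithin_of_forall fun t ht => ?_)
  exact (sq_mul_lt_of_lt_flowScaleOf ht.1 ht.2).le

/-- **Antitonicity in the profile**: a pointwise larger density on `(0, ∞)` reaches the level
earlier, `t₀(e₂) ≤ t₀(e₁)` (provided `e₁` reaches it at all). [folklore] -/
theorem flowScaleOf_antitone {e₁ e₂ : ℝ → ℝ} (hne : (flowScaleSet e₁).Nonempty)
    (h : ∀ t, 0 < t → e₁ t ≤ e₂ t) : flowScaleOf e₂ ≤ flowScaleOf e₁ :=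
  csInf_le_csInf (bddBelow_flowScaleSet e₂) hne fun t ht =>
    ⟨ht.1, ht.2.trans (mul_le_mul_of_nonneg_left (h t ht.1) (sq_nonneg t))⟩

/-- Worked value: the constant profile `e ≡ 3 / (10 t₁²)` (`t₁ > 0`) has `t₀ = t₁`, since
`t ↦ t² e(t) = 0.3 (t/t₁)²` is increasing and equals `0.3` at `t₁`. [folklore] -/
theorem flowScaleOf_const_eq {t₁ : ℝ} (ht₁ : 0 < t₁) :
    flowScaleOf (fun _ => 3 / (10 * t₁ ^ 2)) = t₁ := by
  refine flowScaleOf_eq_of_strictMonoOn (fun s hs t _ hst => ?_) ht₁ (by field_simp)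
  simp only
  have hs' : (0 : ℝ) < s := hs
  have : s ^ 2 < t ^ 2 := by nlinarith
  exact mul_lt_mul_of_pos_right this (by positivity)

/-! ### `t₀(β, S)` of the torus Wilson measure -/

section Torus

variable {d N : ℕ} {G : Type*} [Group G] [TopologicalSpace G] [IsTopologicalGroup G]
  [CompactSpace G] [MeasurableSpace G] [BorelSpace G]

/-- The **expected profile** `t ↦ ⟨E_t⟩_{β,S} = ∫ E t (torusLift S U) dμ_{S,β}(U)` of a
flow-time-indexed observable `E` (read on the periodic lift) under the Wilson measure at inverse
coupling `β` on the torus `(ℤ/Sℤ)ᵈ`; by translation invariance of `μ_{S,β}` the base point of the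
density is immaterial. [cite: Luscher2010, §3.3] -/
def flowProfile (ρ : G →* Matrix (Fin N) (Fin N) ℂ) (E : ℝ → LGConfig d G → ℝ) (β : ℝ) (S : ℕ)
    [NeZero S] (t : ℝ) : ℝ :=
  ∫ U, E t (torusLift S U) ∂(wilsonMeasure (d := d) (L := S) ρ β)

/-- **Lüscher's flow scale `t₀(β, S)`** (lattice units) of lattice `G`-gauge theory with Wilson's
action in the representation `ρ` at inverse coupling `β` on the torus of side `S`:
`t₀ = inf {t > 0 | t² ⟨E_t⟩_{β,S} ≥ 0.3}` for the flowed action density `E` (intended: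
`E t U = 2 ∑_{p ∋ 0} Re tr{1 − ρ(V_t(U)_p)}` of the Wilson flow `V_t`, eqs. (1.4), (3.1), or its
clover variant), junk value `0` if the level is never reached. [cite: Luscher2010, §3.4 eq. (3.3)] -/
def flowScale (ρ : G →* Matrix (Fin N) (Fin N) ℂ) (E : ℝ → LGConfig d G → ℝ) (β : ℝ) (S : ℕ)
    [NeZero S] : ℝ :=
  flowScaleOf (flowProfile ρ E β S)

/-- `flowScale` unfolded. [folklore] -/
theorem flowScale_eq (ρ : G →* Matrix (Fin N) (Fin N) ℂ) (E : ℝ → LGConfig d G → ℝ) (β : ℝ)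
    (S : ℕ) [NeZero S] :
    flowScale ρ E β S = sInf {t | 0 < t ∧ 3 / 10 ≤ t ^ 2 * flowProfile ρ E β S t} := rfl

/-- `t₀(β, S) ≥ 0`. [folklore] -/
theorem flowScale_nonneg (ρ : G →* Matrix (Fin N) (Fin N) ℂ) (E : ℝ → LGConfig d G → ℝ) (β : ℝ)
    (S : ℕ) [NeZero S] : 0 ≤ flowScale ρ E β S :=
  flowScaleOf_nonneg _

/-- The normalised Haar measure of the compact group `G` has total mass `1`
(`Measure.haarMeasure_self` with `K₀ = ⊤`). Local copy (import hygiene, module docstring) of the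
instance in `StrongCouplingActivities`. [folklore] -/
private theorem FlowScale.isProbabilityMeasure_haarProbability :
    IsProbabilityMeasure (haarProbability G) :=
  ⟨by simpa [haarProbability] using Measure.haarMeasure_self (G := G) (K₀ := ⊤)⟩

omit [IsTopologicalGroup G] [MeasurableSpace G] [BorelSpace G] in
/-- The Wilson action of a continuous representation is bounded on the (compact) configuration
space of a finite torus: `|S(U)| ≤ #plaquettes · (N + sup |Re tr ρ|)`. Local copy (import hygiene)
of `exists_abs_wilsonAction_le` of `LatticeGaugeProofs`. [folklore] -/
private theorem FlowScale.exists_abs_wilsonAction_le' {ρ : G →* Matrix (Fin N) (Fin N) ℂ}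
    (hρ : Continuous ρ) (S : ℕ) [NeZero S] :
    ∃ B : ℝ, ∀ U : GaugeConfig d S G, |wilsonAction ρ U| ≤ B := by
  have hc : Continuous fun g : G => (ρ g).trace.re := Complex.continuous_re.comp hρ.matrix_trace
  obtain ⟨M, hM⟩ := isCompact_univ.exists_bound_of_continuousOn hc.continuousOn
  refine ⟨∑ _p : Plaquette d S, ((N : ℝ) + M), fun U => ?_⟩
  unfold wilsonAction
  refine (Finset.abs_sum_le_sum_abs _ _).trans (Finset.sum_le_sum fun p _ => ?_)
  refine (abs_sub _ _).trans ?_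
  rw [Nat.abs_cast]
  exact add_le_add le_rfl (by simpa [Real.norm_eq_abs] using hM _ (Set.mem_univ _))

/-- For a continuous representation the torus Wilson measure is a probability measure
(`0 < Z < ∞` from `e^{-|β|B} ≤ e^{-β S(U)} ≤ e^{|β|B}`). Local copy (import hygiene, module
docstring) of `isProbabilityMeasure_wilsonMeasure` of `LatticeGaugeProofs`, which remains the
public name. [folklore] -/
private theorem FlowScale.isProbabilityMeasure_wilsonMeasure' {ρ : G →* Matrix (Fin N) (Fin N) ℂ}
    (hρ : Continuous ρ) (β : ℝ) (S : ℕ) [NeZero S] :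
    IsProbabilityMeasure (wilsonMeasure (d := d) (L := S) (G := G) ρ β) := by
  haveI : IsProbabilityMeasure (haarProbability G) := FlowScale.isProbabilityMeasure_haarProbability
  obtain ⟨B, hB⟩ := FlowScale.exists_abs_wilsonAction_le' (d := d) hρ S
  set π : Measure (GaugeConfig d S G) := Measure.pi fun _ : Edge d S => haarProbability G with hπ
  have hZ : partitionFunction (d := d) (L := S) ρ β =
      ∫⁻ U, ENNReal.ofReal (Real.exp (-β * wilsonAction ρ U)) ∂π := by
    simp only [partitionFunction, wilsonWeight, withDensity_apply _ MeasurableSet.univ,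
      Measure.restrict_univ, hπ]
  have hbound : ∀ U : GaugeConfig d S G, |β * wilsonAction ρ U| ≤ |β| * B := fun U => by
    rw [abs_mul]; exact mul_le_mul_of_nonneg_left (hB U) (abs_nonneg _)
  have hlow : ENNReal.ofReal (Real.exp (-(|β| * B))) ≤ partitionFunction (d := d) (L := S) ρ β := by
    rw [hZ]
    calc ENNReal.ofReal (Real.exp (-(|β| * B)))
        = ∫⁻ _U, ENNReal.ofReal (Real.exp (-(|β| * B))) ∂π := by
          rw [lintegral_const, measure_univ, mul_one]
      _ ≤ _ := lintegral_mono fun U => ENNReal.ofReal_le_ofReal (Real.exp_le_exp.2 (by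
          have := (abs_le.1 (hbound U)).2
          linarith))
  have hup : partitionFunction (d := d) (L := S) ρ β ≤ ENNReal.ofReal (Real.exp (|β| * B)) := by
    rw [hZ]
    calc _ ≤ ∫⁻ _U, ENNReal.ofReal (Real.exp (|β| * B)) ∂π :=
          lintegral_mono fun U => ENNReal.ofReal_le_ofReal (Real.exp_le_exp.2 (by
            have := (abs_le.1 (hbound U)).1
            linarith))
      _ = _ := by rw [lintegral_const, measure_univ, mul_one]
  have h0 : partitionFunction (d := d) (L := S) ρ β ≠ 0 :=
    (lt_of_lt_of_le (ENNReal.ofReal_pos.2 (Real.exp_pos _)) hlow).ne'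
  have htop : partitionFunction (d := d) (L := S) ρ β ≠ ⊤ :=
    ne_top_of_le_ne_top ENNReal.ofReal_ne_top hup
  constructor
  simp only [wilsonMeasure, Measure.smul_apply, smul_eq_mul]
  exact ENNReal.inv_mul_cancel h0 htop

/-- For a configuration-independent observable the torus flow scale is the flow scale of its
profile (the Wilson measure of a continuous representation is a probability measure). [folklore] -/
theorem flowScale_const {ρ : G →* Matrix (Fin N) (Fin N) ℂ} (hρ : Continuous ρ) (e : ℝ → ℝ)
    (β : ℝ) (S : ℕ) [NeZero S] :
    flowScale ρ (fun t (_ : LGConfig d G) => e t) β S = flowScaleOf e := by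
  haveI := FlowScale.isProbabilityMeasure_wilsonMeasure' (d := d) hρ β S
  have h : flowProfile ρ (fun t (_ : LGConfig d G) => e t) β S = e := by
    funext t
    simp [flowProfile]
  rw [flowScale, h]

end Torus

/-! ### The `t₀`-scheme -/

section Scheme

variable {G : Type} [Group G] [TopologicalSpace G] [IsTopologicalGroup G] [CompactSpace G]
  [MeasurableSpace G] [BorelSpace G]

/-- **Data of the `t₀`-scheme** for the lattice representation `r` and flowed density `E`:
inverse couplings `β_k`, torus half-sides `L_k` (sides `2L_k+1`), multiplicative species
renormalisations `c_s(k)` (NOT fixed by the flow scale; e.g. a flowed two-point normalisation of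
the curvature species, supplied by the consumer), and the three admissibility conditions making
`a_k := t₀(β_k, 2L_k+1)^{-1/2}` a scaling sequence: `t₀ > 0` at every step (automatic once the
level is reached, `flowScaleOf_pos`), `t₀ → ∞` in lattice units (`a_k → 0`), and
`L_k / √t₀ → ∞` (`a_k L_k → ∞`). [cite: Luscher2010, §3.5 (b)] -/
structure FlowSchemeData (r : LatticeRep G) (E : ℝ → LGConfig 4 G → ℝ) where
  /-- inverse bare couplings -/
  β : ℕ → ℝ
  /-- torus half-sides -/
  L : ℕ → ℕ
  /-- multiplicative renormalisations of the species -/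
  c : YMSpecies G → ℕ → ℝ
  flowScale_pos : ∀ k, 0 < flowScale r.ρ E (β k) (2 * L k + 1)
  tendsto_flowScale : Tendsto (fun k => flowScale r.ρ E (β k) (2 * L k + 1)) atTop atTop
  tendsto_div_sqrt :
    Tendsto (fun k => (L k : ℝ) / Real.sqrt (flowScale r.ρ E (β k) (2 * L k + 1))) atTop atTop

namespace FlowSchemeData

variable {r : LatticeRep G} {E : ℝ → LGConfig 4 G → ℝ}

/-- The reference flow time `t₀(β_k, 2L_k+1)` at step `k` (lattice units). [cite: Luscher2010, §3.4 eq. (3.3)] -/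
def t0 (D : FlowSchemeData r E) (k : ℕ) : ℝ := flowScale r.ρ E (D.β k) (2 * D.L k + 1)

/-- `t0` unfolded. [folklore] -/
theorem t0_eq (D : FlowSchemeData r E) (k : ℕ) :
    D.t0 k = flowScale r.ρ E (D.β k) (2 * D.L k + 1) := rfl

/-- `t₀ > 0` at every step. [folklore] -/
theorem t0_pos (D : FlowSchemeData r E) (k : ℕ) : 0 < D.t0 k := D.flowScale_pos k

/-- **The `t₀`-scheme** of `D`: the `SpeciesScheme (YMSpecies G)` with lattice spacings
`a_k := t₀(β_k, 2L_k+1)^{-1/2}` (the flow's own scale setting: `t₀ = 1` in physical units),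
couplings `β_k`, half-sides `L_k`, renormalisations `c_s(k)`, and additive counterterms the
exact vacuum subtraction `m_s(k) := ∫ s(torusLift (2L_k+1) U) dμ_{2L_k+1, β_k}(U)`. [cite: Luscher2010, §3.5 (b)] [cite: JaffeWitten2000, §6] -/
def toSpeciesScheme (D : FlowSchemeData r E) : SpeciesScheme (YMSpecies G) where
  a k := (Real.sqrt (D.t0 k))⁻¹
  a_pos k := inv_pos.2 (Real.sqrt_pos.2 (D.t0_pos k))
  tendsto_a := tendsto_inv_atTop_zero.comp (Real.tendsto_sqrt_atTop.comp D.tendsto_flowScale)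
  β := D.β
  L := D.L
  tendsto_L := by
    have h := D.tendsto_div_sqrt
    simpa [div_eq_inv_mul, t0] using h
  c := D.c
  m s k := ∫ U, s.F (torusLift (2 * D.L k + 1) U)
    ∂(wilsonMeasure (d := 4) (L := 2 * D.L k + 1) r.ρ (D.β k))

/-- Couplings of the `t₀`-scheme. [folklore] -/
@[simp] theorem toSpeciesScheme_β (D : FlowSchemeData r E) : D.toSpeciesScheme.β = D.β := rfl

/-- Half-sides of the `t₀`-scheme. [folklore] -/
@[simp] theorem toSpeciesScheme_L (D : FlowSchemeData r E) : D.toSpeciesScheme.L = D.L := rfl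

/-- Sides `2L_k+1` of the `t₀`-scheme. [folklore] -/
@[simp] theorem toSpeciesScheme_side (D : FlowSchemeData r E) (k : ℕ) :
    D.toSpeciesScheme.side k = 2 * D.L k + 1 := rfl

/-- Renormalisations of the `t₀`-scheme. [folklore] -/
@[simp] theorem toSpeciesScheme_c (D : FlowSchemeData r E) : D.toSpeciesScheme.c = D.c := rfl

/-- Spacings of the `t₀`-scheme: `a_k = t₀(β_k, 2L_k+1)^{-1/2}`. [cite: Luscher2010, §3.5 (b)] -/
theorem toSpeciesScheme_a (D : FlowSchemeData r E) (k : ℕ) :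
    D.toSpeciesScheme.a k = (Real.sqrt (D.t0 k))⁻¹ := rfl

/-- **Exact vacuum subtraction**: `m_s(k) = ⟨s ∘ torusLift⟩` under the scheme's own torus Wilson
measure at step `k`. [cite: JaffeWitten2000, §6] -/
theorem toSpeciesScheme_m (D : FlowSchemeData r E) (s : YMSpecies G) (k : ℕ) :
    D.toSpeciesScheme.m s k = ∫ U, s.F (torusLift (D.toSpeciesScheme.side k) U)
      ∂(wilsonMeasure (d := 4) (L := D.toSpeciesScheme.side k) r.ρ (D.toSpeciesScheme.β k)) :=
  rfl

/-- **Scale setting**: in the physical units of the `t₀`-scheme the reference flow time is `1`,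
`a_k² · t₀(β_k, 2L_k+1) = 1`. [cite: Luscher2010, §3.5 (b)] -/
theorem toSpeciesScheme_a_sq_mul_t0 (D : FlowSchemeData r E) (k : ℕ) :
    D.toSpeciesScheme.a k ^ 2 * D.t0 k = 1 := by
  rw [toSpeciesScheme_a, inv_pow, Real.sq_sqrt (D.t0_pos k).le,
    inv_mul_cancel₀ (D.t0_pos k).ne']

end FlowSchemeData

end Scheme

end Literature.MathematicalPhysics.QuantumLattice

end
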